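import Summits.ResolutionOfSingularities.ResolutionOfSingularities.Theorems.HilbertSamuelEliminationSigmaMaxModificationsCorridor3WLadderStrataBirthsTopDictionaryGraded
import Summits.ResolutionOfSingularities.ResolutionOfSingularities.Theorems.HilbertSamuelEliminationSigmaMaxModificationsCorridor3WLadderStrataBirthsMovingDefs
import HarnessLib

/-!
# [OURS · L1 W4.2] `Corridor3WLadderStrataBirthsTopRebirth` — the CURVE-CENTRE REBIRTH DICTIONARY `RebirthDictionary3` (sibling of
# `BirthDictionary3`, keyed to res-type-040's DEPTH-JUMP event)

Crux chain w42 (`SigmaMaxModifications`, stmt-ResolutionOfSingularities-18506; conjunct stmt-ResolutionOfSingularities-19249). res-L1-w42-plan-1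
RULINGS v3.13-1 (AG) 09:02:58Z: «to res-type-067 (additive sibling, your vocabulary): `def RebirthDictionary3 (p : ℕ) : Prop` — same prefix as
`BirthDictionary3` but hypothesis «a depth jump through the chain point: `Z′ ∈ componentsThrough 3 ν s′` with `HasSandwichAt s′ Z′` whose image
closure is a component WITHOUT sandwich at `s`» in place of `∃ Z′, IsFibreBirthAt …`, conclusion `RuledBirthDatumD u h` in every adapted frame (OURS
CLAIM; discharge = 002's band computation along `D` applied to the dominating component: the whole `ℙ¹` over `x_n` near ⇒ the `D`-transversal
initial forms vanish at `x_n`, births or rebirths alike)». res-type-040's D13 reduction «LATE MOVING BIRTHS NEED LATE RULED REBIRTHS» (PACE 08:58:02Z;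
Defs p517068: `HasSandwichAt`, row `StrataCycleEndNoDepthJumps`, binder `StrataDepthDiscipline`) then closes its ROW-J by
`strataCycleEndNoDepthJumps_three_of_dictionary (hre : RebirthDictionary3 p) (hrec : NoRuledBirth3 p) (hdich : CycleEndCentreDichotomy3 p) (hD : …)`
— `NoRuledBirth3` (p515936) quantifies over ALL blown-up cycle-end steps and ALL centre-adapted frames with no birth hypothesis, so ONE eventual
law serves births and rebirths (confirmed 09:04:35Z). Typer res-type-067 (gen 11). OURS (cell res-hironaka, slot W4.2); NOT a statement of
H. Hironaka's manuscript [Hironaka2017] nor of [CossartJannsenSaito2020]; AI-typed, weaker than expert review. Helper file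
`--supports stmt-ResolutionOfSingularities-19249 --as helper` (counted 0). ONE `def … : Prop` (an OURS CLAIM, consumed as a hypothesis).
-/

noncomputable section

set_option linter.dupNamespace false

open CategoryTheory AlgebraicGeometry TopologicalSpace Topology Polynomial
open Summit.ResolutionOfSingularities.ResolutionOfSingularities.Theorems.CampaignW42
open Literature.AlgebraicGeometry.Resolution Literature.RingTheory.HilbertSamuel
open Summit.ResolutionOfSingularities.ResolutionOfSingularities.Theorems.SigmaMaxModificationsCorridor3

namespace Summit.ResolutionOfSingularities.ResolutionOfSingularities.Theorems.SigmaMaxModificationsCorridor3.Moving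

universe u

/-- [OURS · L1 W4.2] **THE CURVE-CENTRE REBIRTH DICTIONARY** (RULINGS v3.13-1 (AG)). Along every chain of canonical near steps from a maximal
origin (functional admissible oracle), at every BLOWN-UP CYCLE-END step from an `ē = 3` stage, for every canonical centre `C` and step projection
`f`: a DEPTH JUMP through the chain point — a component `Z'` of `X_{n+1}(ν)` through `x_{n+1}` WITH a sandwich at `x_{n+1}` (`HasSandwichAt`,
res-type-040 p517068: depth `≥ 2`, «surface») DOMINATING a component of `X_n(ν)` WITHOUT a sandwich at `x_n` (depth `≤ 1`, «curve», reborn as a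
surface containing the whole fibre `ℙ(Dir_{x_n}/T_{x_n}D) ≅ ℙ¹`) — yields, in EVERY CP frame of `x_n` adapted to `C` (`IsCPFrameAlong`: the centre
germ is the regular curve `V(X, u₁, u₂)`), the RULED-BIRTH DATUM `RuledBirthDatumD u h` of that frame (p515936: every `u₀`-free minimal exponent
of every coefficient `h_i` has transversal degree `≥ 2(m − i)`). OURS CLAIM — the scheme ↔ graded dictionary for REBIRTHS, NOT proved here (its
discharge is res-D-pv-002's T0c/T1c/T2c band computation along `D` applied to the dominating component, which does not use that the near
component is new); consumed only as a hypothesis (res-type-040's ROW-J closer). NOT a statement of any manuscript. -/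
def RebirthDictionary3 (p : ℕ) : Prop :=
  ∀ (R : ∀ S : Scheme.{u}, CentreSeq S → Prop), OracleFunctional R → OracleAdmissible R →
  ∀ (ν : ℕ → ℕ) (X : Scheme.{u}) [IsLocallyNoetherian X] (x : X), IsMaximalOrigin p 3 ν X x →
  ∀ (s s' : MarkedStage.{u}), Reaches R 3 ν (MarkedStage.init X x) s → CanonicalNearStep R 3 ν s s' → s.geomDirDim = 3 →
    s.IsBlownUp R 3 ν → s'.P = none →
    ∀ (C : s.W.IdealSheafData) (P' : Option (Pending (blowup C))), IsCanonicalStep R 3 ν s.L s.P C P' →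
    ∀ (f : s'.W ⟶ s.W), StepProjection R 3 ν s s' f →
      (∃ Z' ∈ componentsThrough 3 ν s', HasSandwichAt s' Z' ∧
        closure (f.base '' Z') ∈ componentsIn (Scheme.hsStratum s.W 3 ν) ∧ ¬ HasSandwichAt s (closure (f.base '' Z'))) →
      ∀ (Rf : Type) (_ : CommRing Rf) (u : Fin 3 → Rf) (h : Rf[X]) (φ : (s.W.presheaf.stalk s.pt : Type u) →+* Rf[X] ⧸ Ideal.span {h}),
        IsCPFrameAlong s C Rf u h φ → RuledBirthDatumD u h

end Summit.ResolutionOfSingularities.ResolutionOfSingularities.Theorems.SigmaMaxModificationsCorridor3.Moving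

end
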